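/-
Copyright (c) 2026. All rights reserved.
Released under Apache 2.0 license as described in the file LICENSE.
-/
import Literature.AlgebraicGeometry.ComplexMultiplication.HyperellipticJacobianCMCurveTimesOddSimpleFactorWeilType
import Literature.AlgebraicGeometry.ComplexMultiplication.HyperellipticJacobianFourTimesPrimeSimpleFactorExceptionalClasses
import Literature.AlgebraicGeometry.Pohlmann1968.CorankOneCMFamilyWeilSection
import Literature.AlgebraicGeometry.ComplexMultiplication.MultiFieldWeilCurveAbsorption
import HarnessLib

/-!
# The Hodge ring of `E_i × Y_{4p}` (`p ≡ 3 (mod 4)` prime, `p ≥ 7`) is `B• = D• ⊕ W_{ℚ(i)}`: F44's exceptional class IS the Weil class of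
# `k = ℚ(i) ↪ End⁰(E_i) × End⁰(Y_{4p})`, `(E_i × Y_{4p}, ι(ζ_4³) ⊕ ι(ζ_{4p}^p))` is of WEIL TYPE `((p+1)/4, 1)`, and the Hodge conjecture for
# `E_i × Y_{4p}` is EQUIVALENT to the algebraicity of that one Weil plane (`p = 7`: true by Markman's fourfold theorem)

Family `hodge`, cell `pub-hodgecm2` (COR-CM), KEPT Literature lane `lit-deligne-3` (generation 56, file F51b; sequel of F44
`HyperellipticJacobianFourTimesPrimeSimpleFactorExceptionalClasses`, F48–F49 (the `ℚ(i)`-multiplicities), and of F51a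
`Pohlmann1968/CorankOneCMFamilyWeilSection` (CM-algebra families of corank `≤ 1` with a balanced transversal)).  THEOREMS ONLY: no
definition, no named fact, no `sorry`, no instance; D-0026 net debt `0`.  HC_CM is NOT proved.

## The print

* B. Moonen, Yu. Zarhin, Math. Ann. **315** (1999) [MoonenZarhin1999LowDim] (held `paper:arxiv-math_9901113` p. 1), Thm. 0.1: «(a) `X` is isogenous
  to a product `X₁ × X₂` where `X₁` is an elliptic curve with complex multiplication by an imaginary quadratic field `k` and where `X₂` is a simple
  abelian threefold such that there exists an embedding `k ↪ End⁰(X₂)` […] (1) Suppose we are in case (a) or (b). Then the Hodge ring `B•(X)` is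
  generated by the subalgebra `D•(X)` of divisor classes together with the space of Weil classes `W_k ⊂ B²(X)` […] `D²(X) ≠ B²(X)`»; §1 (1.9).
  For `p = 7` our `E_i × Y_{28}` (`Y_{28}` a simple CM threefold with `i = ζ_{28}^7 ∈ ℚ(ζ_{28} − ζ_{28}^{−1})`) IS case (a); this file proves the
  printed conclusion (1) for it and for the whole family `E_i × Y_{4p}`, `p ≡ 3 (mod 4)`, of dimension `(p+1)/2 = 4, 6, 8, 10, 12, …`.
* B. van Geemen, LNM 1594 (1994) [vanGeemen1994HodgeAV] 4.9–4.10, Thm. 6.12 (Weil 1977: «`Bᵖ(X) = Dᵖ` for `p ≠ n`, `Bⁿ(X) = Dⁿ ⊕ ⋀_K^{2n} H¹`»),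
  1.1 (Weil's question); E. Markman [Markman2025SurveySecant] Thm. 1.2 (Weil classes on abelian fourfolds of Weil type are algebraic; tree named fact
  `Markman2025_weilClasses_algebraic_abelianFourfold`, used here ONLY as an explicit hypothesis in §6); H. Yanai 2015 [Yanai2015IndexDegeneracy] §5
  («when `p ≡ 3 (mod 4)`, `dim MT(A) = dim A + 1`» — the rank of `Y_{4p}`, tree `cmTypeRank_eq_of_level_fourMulPrime`); Gallese–Goodson–Lombardo
  [GalleseGoodsonLombardo2024] §3 Thm. 3.0 (5) (`X_{4p} ∼ Y_{4p}²`, `Y_{4p}` simple with CM by `ℚ(ζ_{4p} − ζ_{4p}^{−1})`), Lemma 11–12; Deligne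
  [Deligne1982HodgeCycles] I Ex. 3.7, §4 Prop. 4.4; Gordon [Gordon1999HodgeAVSurvey] 7.4–7.7, 9.1–9.5; Gao–Ullmo [GaoUllmo2025] Thm. 3.1.

## What is proved (data: `A_0 = E_i` kept whole as `(⊤ ≤ ℚ(ζ_4); Ψ_0 = Φ_4^⊤)`, `Y = B_1 ⊨ (L_1; Ψ_1)` with `L_1 ∋ ζ − ζ^{−1}, ζ^p` of index `2`
## in `ℚ(ζ_{4p})` and `Ψ_1^K = Φ_{4p}` — the sub-pair data of F42/F44 — realisations `B_i ⊨ (L_i; Ψ_i)`; `a = (ζ_4³, ζ_{4p}^p) ∈ ∏ 𝓞_{L_i}`, so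
## `a_i² = −1` and `i ↦ a` embeds `k = ℚ(i)` diagonally; `T_a = {(i, s) : s(a_i) = i}` the Weil fibre; `m = (p+1)/4`)

* §1 bookkeeping: `ncard_sigma_eq_sum` (a count on `⊔_i Hom(L_i, ℂ)` is the sum of the slot counts), `ncard_restrict_eq_mul` (counts on `K`
  versus `L` along a sub-pair of index `[K:L]`), `rootζ_four_eq_I` (`e^{2πi/4} = i`).
* §2 `sq_a_eq` (`a_i² = −1`), `sum_finrank_eq` (`[L_0:ℚ] + [L_1:ℚ] = p + 1`), **`le_cmFamilyRank`** (`(p+1)/2 ≤ cmFamilyRank Ψ`: the family has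
  corank `≤ 1`, from Yanai's rank of the member `Y_{4p}`).
* §3 **`ncard_weilFibre_inter_eq`** ∕ **`isGaloisBalancedAlg_weilFibre`** — by F48/F49's multiplicities `k = ℚ(i)` acts with multiplicities
  `((p+1)/4, (p+1)/4)`: the Weil fibre `T_a` satisfies Pohlmann's condition.
* §4 **`weilFibre_not_mem_pohlmannDivisorSetsAlg`** — `T_a` is not a divisor set (F44's exceptional weight exists on the sub-pair; by F51a's
  classification it is `T_a` or `T̄_a`).
* §5 THE HODGE RING: **`hodgeClassSpan_eq_divisorClassesSpan_of_ne`** (`B^q(E_i ⊕ Y_{4p}) ⊗ ℂ = D^q ⊗ ℂ` for `4q ≠ p + 1`),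
  **`hodgeClassSpan_eq_divisorClassesSpan_sup_weilClassesOf`** (`B^m ⊗ ℂ = D^m ⊗ ℂ ⊔ W_k ⊗ ℂ`, `W_k ⊗ ℂ = weilClassesOf (E_i ⊕ Y_{4p}) (ι(a_0) ⊕ ι(a_1)) m 1`),
  **`isWeilType`** (`(E_i ⊕ Y_{4p}, ι(a_0) ⊕ ι(a_1))` is of WEIL TYPE `(m, 1)` — the Hodge-structure statement F49 left open),
  **`weightClassesAlg_le_weilClassesOf_of_mem_diff`** (EVERY exceptional weight line — in particular F44's class — lies in the Weil plane),
  `mem_pohlmannSetsAlg_diff_iff` (the exceptional weights are exactly `T_a, T̄_a`), `ncard_pohlmannSetsAlg_diff_eq_two` (`dim B^m = dim D^m + 2`),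
  `isDivisorWeilGenerated`, **`hodgeConjectureFor_iff_weilClasses_algebraic`** (HC for `E_i ⊕ Y_{4p}` ⟺ the rational `(m,m)` Weil classes of
  `ι(a_0) ⊕ ι(a_1)` are algebraic) and `hodgeConjectureFor_prod_of_weilClasses_algebraic` (`E_i × Y_{4p}`).
* §6 `p = 7`: **`hodgeConjectureFor_of_markman_seven`** — GIVEN the named fact `Markman2025_weilClasses_algebraic_abelianFourfold`, the Hodge conjecture
  holds for `E_i ⊕ Y_{28}` and `E_i × Y_{28}` (Moonen–Zarhin (a) + Markman; the tree already derives HC for every CM abelian fourfold from that fact —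
  here the route is the explicit one through ONE Weil plane).
* §7 from realisations `A_0 ⊨ (ℚ(ζ_4); Φ_4)`, `A_1 ⊨ (ℚ(ζ_{4p}); Φ_{4p})`: `exists_data` (the sub-pair data with `a`), and the hypothesis-free family
  statement **`exists_cmCurve_simple_odd_weilType_hodgeRing`**: for every prime `p ≡ 3 (mod 4)`, `p ≥ 7`, a CM elliptic curve `E` and a SIMPLE CM
  `(p−1)/2`-fold `Y` with an endomorphism `φ` of `E ⊕ Y`, `φ² = −1`, of Weil type `((p+1)/4, 1)`, `B = D` off the middle degree, `B^m = D^m ⊔ W`,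
  `B^m ≠ D^m`, and `HC(E ⊕ Y) ⟺` the Weil classes of `φ` are algebraic.
* §8 (appended) **`nonempty_ringHom_subPair`** (`k = L_0 = ℚ(i) ↪ L_1`: Moonen–Zarhin's hypothesis «`k ↪ End⁰(X₂)`» as a ring map, via the
  splitting field `ℚ(ζ_4)` of `X⁴ − 1` and the primitive fourth root `ζ^p ∈ L_1`), `isNondegenerate_subPair_one` (`Y_{4p}` is nondegenerate),
  **`cmFamilyRank_eq`**: `cmFamilyRank Ψ = (p+1)/2 = cmTypeRank Ψ_1 = (Σ_i [L_i:ℚ])/2` — THE CURVE IS ABSORBED (`MultiFieldWeil` curve absorption: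
  quadratic slot embedded in a member of odd half-degree `(p−1)/2`): `rank Hg(E_i × Y_{4p}) = rank Hg(Y_{4p})`, `Hg(E_i × Y_{4p}) ≠ Hg(E_i) × Hg(Y_{4p})`
  (Moonen–Zarhin (a); g54's numerics «`rank MT(X_4 × Y_{4p}) = rank MT(Y_{4p})`» as a theorem), the pair has corank EXACTLY one.

HONEST.  The identification «exceptional classes = Weil classes of `ℚ(i)`» and `B• = D• ⊕ W_k` for all `p ≡ 3 (mod 4)` are ASSEMBLED from the tree
(Pohlmann–Gao–Ullmo, Kubota's defect count, Yanai's rank, F44/F48/F49); Moonen–Zarhin print the case `p = 7` (dimension 4).  Nothing here asserts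
the algebraicity of a Weil class: for `p = 7` it is the displayed hypothesis (Markman's theorem, a named fact of the tree), for `p ≥ 11` (dimension
`≥ 6`, Weil type `(m,1)` with `m ≥ 3`) it is open (van Geemen 1.1; Markman's sixfold theorem needs discriminant `−1`, not examined).  HC_CM is NOT proved.

## References
* [MoonenZarhin1999LowDim] B. Moonen, Yu. Zarhin, Math. Ann. 315 (1999) 711–733: Introduction (a), Thm. 0.1 (1), §1 (1.9).
* [vanGeemen1994HodgeAV] B. van Geemen, LNM 1594 (1994): 1.1, 4.9–4.10, Lemma 5.2, Thm. 6.12.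
* [Markman2025SurveySecant] E. Markman, *Secant sheaves and Weil classes on abelian varieties* (2025): Thm. 1.2, §11.5 Step 2.
* [Yanai2015IndexDegeneracy] H. Yanai (2015): §5 (p. 819).
* [GalleseGoodsonLombardo2024] A. Gallese, H. Goodson, D. Lombardo (2024): §3 Thm. 3.0 (5), §3.2 Lemma 11–12.
* [Deligne1982HodgeCycles] P. Deligne, LNM 900 (1982): I Ex. 3.7, §4 Prop. 4.4.
* [Gordon1999HodgeAVSurvey] B. B. Gordon (1999): 5.13, 7.4–7.7, 9.1, §9.2, 9.4, 9.5.
* [GaoUllmo2025] Z. Gao, E. Ullmo (2025): Thm. 3.1.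
* [Shimura1998] G. Shimura (1998): §6.2 Thm. 3, §8.2 Prop. 26, §18.1.
* [Washington1997] L. C. Washington, *Introduction to Cyclotomic Fields*: Thm. 2.5, Ch. 2.
* [MumfordAV1970] D. Mumford, *Abelian Varieties*: §19 Thm. 1, §22.
-/

noncomputable section

open CategoryTheory CategoryTheory.Limits NumberField Module

namespace Literature.AlgebraicGeometry.ComplexMultiplication

open Literature.AlgebraicGeometry.Motives
open Literature.AlgebraicGeometry.Motives.AbelianVariety
open Literature.AlgebraicGeometry.HodgeTheory (complexBetti IsRationalClass IsOfHodgeType IsStablyNondegenerate IsDivisorGenerated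
  HodgeConjectureFor IsWeilType IsDivisorWeilGenerated weilClassesOf algebraicClasses Markman2025_weilClasses_algebraic_abelianFourfold)
open Literature.AlgebraicGeometry.VanGeemen1994 (hodgeClassSpan)
open Literature.Barriers.HodgeConjecture (divisorClassesSpan)
open Literature.NumberTheory.ComplexMultiplication
open Literature.AlgebraicGeometry.ComplexMultiplication.CMWeights
open Literature.AlgebraicGeometry.ComplexMultiplication.PairWeights

namespace HyperellipticJacobian

open Literature.AlgebraicGeometry.Pohlmann1968 Literature.AlgebraicGeometry.Pohlmann1968.Cyclotomic

open scoped Classical Pointwise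

/-! ## §1 Bookkeeping: slot counts, counts along a sub-pair, `e^{2πi/4} = i` -/

section Bookkeeping

/-- **A count on `⊔_i Hom(F_i, ℂ)` is the sum of the slot counts.** [cite: Deligne1982HodgeCycles, I Ex. 3.7 (p. 25)] -/
theorem ncard_sigma_eq_sum {n : ℕ} {F : Fin n → Type} [∀ i, Field (F i)] [∀ i, NumberField (F i)]
    (Q : ∀ i, (F i →+* ℂ) → Prop) :
    {x : (i : Fin n) × (F i →+* ℂ) | Q x.1 x.2}.ncard = ∑ i, {s : F i →+* ℂ | Q i s}.ncard := by
  have hset : {x : (i : Fin n) × (F i →+* ℂ) | Q x.1 x.2} =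
      ↑(Finset.univ.sigma fun i => Finset.univ.filter fun s : F i →+* ℂ => Q i s) := by
    ext x
    simp only [Set.mem_setOf_eq, Finset.coe_sigma, Set.mem_sigma_iff, Finset.mem_coe, Finset.mem_univ, Finset.mem_filter, true_and]
  rw [hset, Set.ncard_coe_finset, Finset.card_sigma]
  refine Finset.sum_congr rfl fun i _ => ?_
  rw [show {s : F i →+* ℂ | Q i s} = ↑(Finset.univ.filter fun s : F i →+* ℂ => Q i s) by
    ext s; simp only [Set.mem_setOf_eq, Finset.coe_filter, Finset.mem_univ, true_and], Set.ncard_coe_finset]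

/-- **Counts along a sub-pair**: for `(L ≤ K; Ψ)` with `Ψ^K = Φ`, `x ∈ L`, `c ∈ ℂ`: `#{σ ∈ Φ : σ(x) = c} = [K : L] · #{ρ ∈ Ψ : ρ(x) = c}`
(every `ρ` has `[K : L]` extensions, and `σ ∈ Φ ↔ σ|_L ∈ Ψ`). [cite: Shimura1998, §6.2 Thm. 3 (proof)] -/
theorem ncard_restrict_eq_mul {K : Type} [Field K] [NumberField K] {L : IntermediateField ℚ K} {Ψ : CMType L} {Φ : CMType K}
    (hind : inducedCMType (algebraMap L K) Ψ = Φ) (x : L) (c : ℂ) :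
    {σ : K →+* ℂ | σ ∈ Φ.1 ∧ σ (x : K) = c}.ncard = Module.finrank L K * {ρ : L →+* ℂ | ρ ∈ Ψ.1 ∧ ρ x = c}.ncard := by
  have h := card_filter_comp_mem (K := K) (L := L) (Finset.univ.filter fun ρ : L →+* ℂ => ρ ∈ Ψ.1 ∧ ρ x = c)
  have e1 : {σ : K →+* ℂ | σ ∈ Φ.1 ∧ σ (x : K) = c} = ↑(Finset.univ.filter fun σ : K →+* ℂ =>
      σ.comp (algebraMap L K) ∈ (Finset.univ.filter fun ρ : L →+* ℂ => ρ ∈ Ψ.1 ∧ ρ x = c)) := by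
    ext σ
    simp only [Set.mem_setOf_eq, Finset.coe_filter, Finset.mem_filter, Finset.mem_univ, true_and, RingHom.coe_comp,
      Function.comp_apply, ← hind, mem_inducedCMType_iff]
    rfl
  have e2 : {ρ : L →+* ℂ | ρ ∈ Ψ.1 ∧ ρ x = c} = ↑(Finset.univ.filter fun ρ : L →+* ℂ => ρ ∈ Ψ.1 ∧ ρ x = c) := by
    ext ρ
    simp only [Set.mem_setOf_eq, Finset.coe_filter, Finset.mem_univ, true_and]
  rw [e1, e2, Set.ncard_coe_finset, Set.ncard_coe_finset, h]

/-- `e^{2πi/4} = i`. [cite: Washington1997, Ch. 2 (basic cyclotomic relations)] -/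
theorem rootζ_four_eq_I : rootζ 4 = Complex.I := by
  rw [rootζ, show (2 * Real.pi * Complex.I / (4 : ℕ) : ℂ) = (Real.pi / 2 : ℂ) * Complex.I by push_cast; ring, Complex.exp_mul_I]
  rw [show (Real.pi / 2 : ℂ) = ((Real.pi / 2 : ℝ) : ℂ) by push_cast; ring, ← Complex.ofReal_cos, ← Complex.ofReal_sin,
    Real.cos_pi_div_two, Real.sin_pi_div_two]
  simp

/-- `i · √1 = i`. [folklore] -/
private theorem I_mul_sqrt_one : Complex.I * (Real.sqrt ((1 : ℕ) : ℝ) : ℂ) = Complex.I := by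
  rw [Nat.cast_one, Real.sqrt_one, Complex.ofReal_one, mul_one]

end Bookkeeping

/-! ## §2 The data of `E_i × Y_{4p}`: `a = (ζ_4³, ζ_{4p}^p)`, `a_i² = −1`, degrees, and the corank of the family -/

section Data

variable {lev : Fin 2 → ℕ} [∀ i, NeZero (lev i)] {K : Fin 2 → Type} [∀ i, Field (K i)] [∀ i, NumberField (K i)]
  [∀ i, IsCyclotomicExtension {lev i} ℚ (K i)] {Φ : ∀ i, CMType (K i)}
  {L : ∀ i, IntermediateField ℚ (K i)} {Ψ : ∀ i, CMType (L i)} {p : ℕ}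

omit [∀ i, NeZero (lev i)] in
/-- The cyclotomic members are CM fields (levels `> 2`). [cite: Washington1997, Thm. 2.5] -/
theorem isCMField_of_lev (h2 : ∀ i, 2 < lev i) (i : Fin 2) : IsCMField (K i) :=
  IsCyclotomicExtension.Rat.isCMField (K i) (S := {lev i}) ⟨lev i, rfl, h2 i⟩

omit [∀ i, NeZero (lev i)] in
/-- The sub-pair fields `L_i` are CM fields (they carry CM types inside CM fields). [cite: Shimura1998, §18.1 and §8.2 Prop. 26] -/
theorem isCMField_subPair (h2 : ∀ i, 2 < lev i) (Ψ : ∀ i, CMType (L i)) (i : Fin 2) : IsCMField (L i) := by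
  haveI : IsCMField (K i) := isCMField_of_lev h2 i
  exact isCMField_of_cmType_intermediateField (L i) (Ψ i)

omit [∀ i, NeZero (lev i)] [∀ i, NumberField (K i)] [∀ i, IsCyclotomicExtension {lev i} ℚ (K i)] in
/-- `2 < lev i` for the levels `4, 4p`. [folklore] -/
private theorem two_lt_lev (hp : p.Prime) (h0 : lev 0 = 4) (h1 : lev 1 = 4 * p) : ∀ i, 2 < lev i :=
  Fin.forall_fin_two.2 ⟨by rw [h0]; norm_num, by rw [h1]; have := hp.two_le; omega⟩

/-- **`a_i² = −1`**: `(ζ_4³)² = ζ_4⁶ = −1` and `(ζ_{4p}^p)² = ζ_{4p}^{2p} = −1`. [cite: Washington1997, Ch. 2 (basic cyclotomic relations)]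
[cite: MoonenZarhin1999LowDim, §1 (1.9)] -/
theorem sq_a_eq (hp : p.Prime) (h0 : lev 0 = 4) (h1 : lev 1 = 4 * p) (a : ∀ i, 𝓞 (L i))
    (ha : ∀ i, (((a i : L i)) : K i) = zetaOf (lev i) (K i) ^ ((![3, p] : Fin 2 → ℕ) i)) :
    ∀ i, a i * a i = -((1 : ℕ) : 𝓞 (L i)) := by
  have hK : ∀ i, (zetaOf (lev i) (K i) ^ ((![3, p] : Fin 2 → ℕ) i)) ^ 2 = -1 := by
    refine Fin.forall_fin_two.2 ⟨?_, ?_⟩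
    · have hprim : IsPrimitiveRoot (zetaOf (lev 0) (K 0)) (lev 0) := IsCyclotomicExtension.zeta_spec (lev 0) ℚ (K 0)
      have h2 : zetaOf (lev 0) (K 0) ^ 2 = -1 :=
        (hprim.pow (by rw [h0]; norm_num) (show lev 0 = 2 * 2 by rw [h0])).eq_neg_one_of_two_right
      show (zetaOf (lev 0) (K 0) ^ 3) ^ 2 = -1
      calc (zetaOf (lev 0) (K 0) ^ 3) ^ 2 = (zetaOf (lev 0) (K 0) ^ 2) ^ 3 := by ring
        _ = -1 := by rw [h2]; norm_num
    · have hprim : IsPrimitiveRoot (zetaOf (lev 1) (K 1)) (lev 1) := IsCyclotomicExtension.zeta_spec (lev 1) ℚ (K 1)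
      show (zetaOf (lev 1) (K 1) ^ p) ^ 2 = -1
      rw [← pow_mul]
      exact (hprim.pow (by rw [h1]; have := hp.pos; omega) (show lev 1 = p * 2 * 2 by rw [h1]; ring)).eq_neg_one_of_two_right
  intro i
  have hK' := hK i
  rw [← ha i] at hK'
  have hL : ((a i : 𝓞 (L i)) : L i) ^ 2 = -1 := by
    apply (algebraMap (L i) (K i)).injective
    rw [map_pow, map_neg, map_one]
    exact hK'
  apply RingOfIntegers.ext
  show algebraMap (𝓞 (L i)) (L i) (a i * a i) = algebraMap (𝓞 (L i)) (L i) (-((1 : ℕ) : 𝓞 (L i)))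
  rw [map_mul, map_neg, map_natCast, Nat.cast_one, ← sq]
  exact hL

/-- **The degrees: `[L_0 : ℚ] = 2` (`L_0 = ℚ(i)`) and `[L_1 : ℚ] = p − 1` (index `2` in `ℚ(ζ_{4p})`, `φ(4p) = 2(p − 1)`)**, so `Σ_i [L_i:ℚ] = p + 1 =
2 dim(E_i × Y_{4p})`. [cite: GalleseGoodsonLombardo2024, §3 Thm. 3.0 (5)] [cite: Washington1997, Thm. 2.5] -/
theorem finrank_subPair_eq (hp : p.Prime) (hp3 : p % 4 = 3) (h0 : lev 0 = 4) (h1 : lev 1 = 4 * p) (hL0 : L 0 = ⊤)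
    (hfin1 : Module.finrank (L 1) (K 1) = 2) : finrank ℚ (L 0) = 2 ∧ finrank ℚ (L 1) = p - 1 := by
  have hK : ∀ i, finrank ℚ (K i) = (lev i).totient := fun i =>
    IsCyclotomicExtension.finrank (K := ℚ) (n := lev i) (K i) (Polynomial.cyclotomic.irreducible_rat (Nat.pos_of_ne_zero (NeZero.ne _)))
  have hp2 : p ≠ 2 := by omega
  have htot : Nat.totient (4 * p) = 2 * (p - 1) := by
    rw [show 4 = 2 ^ 2 by norm_num, Nat.totient_mul ((Nat.coprime_pow_left_iff (by norm_num) 2 p).2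
      ((Nat.coprime_primes (by decide) hp).2 hp2.symm)), Nat.totient_prime_pow (by decide) (by norm_num), Nat.totient_prime hp]
    norm_num
  constructor
  · have h := hK 0
    rw [h0, show Nat.totient 4 = 2 by decide] at h
    rw [hL0, IntermediateField.finrank_top', h]
  · have htower := Module.finrank_mul_finrank ℚ (L 1) (K 1)
    rw [hfin1, hK 1, h1, htot] at htower
    omega

/-- `Σ_i [L_i : ℚ] = p + 1`. [cite: GalleseGoodsonLombardo2024, §3 Thm. 3.0 (5)] -/
theorem sum_finrank_eq (hp : p.Prime) (hp3 : p % 4 = 3) (h0 : lev 0 = 4) (h1 : lev 1 = 4 * p) (hL0 : L 0 = ⊤)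
    (hfin1 : Module.finrank (L 1) (K 1) = 2) : ∑ i, finrank ℚ (L i) = p + 1 := by
  obtain ⟨hd0, hd1⟩ := finrank_subPair_eq hp hp3 h0 h1 hL0 hfin1
  rw [Fin.sum_univ_two, hd0, hd1]
  have := hp.two_le
  omega

/-- **THE FAMILY `(E_i, Y_{4p})` HAS KUBOTA CORANK `≤ 1`**: `(p+1)/2 ≤ cmFamilyRank Ψ` — the member `Y_{4p}` alone has rank `(p+1)/2` (Yanai §5:
«when `p ≡ 3 (mod 4)`, `dim MT(A) = dim A + 1`», tree `cmTypeRank_eq_of_level_fourMulPrime`; the rank is invariant under induction,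
`cmTypeRank_inducedCMType`, and a member's rank bounds the family's, `cmTypeRank_le_cmFamilyRank`), while `Σ_i [L_i:ℚ] = p + 1`.
[cite: Yanai2015IndexDegeneracy, §5 (p. 819)] [cite: Gordon1999HodgeAVSurvey, 7.7 and 9.4] [cite: Deligne1982HodgeCycles, I Ex. 3.7 (c)] -/
theorem le_cmFamilyRank (hp : p.Prime) (hp3 : p % 4 = 3) (h0 : lev 0 = 4) (h1 : lev 1 = 4 * p)
    (hΦ : ∀ i (σ : K i →+* ℂ), σ ∈ (Φ i).1 ↔ 2 * (expOf (lev i) (K i) σ).val < lev i)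
    (hind : ∀ i, inducedCMType (algebraMap (L i) (K i)) (Ψ i) = Φ i) (hL0 : L 0 = ⊤) (hfin1 : Module.finrank (L 1) (K 1) = 2) :
    (∑ i, finrank ℚ (L i)) / 2 ≤ CMAlgebra.cmFamilyRank Ψ := by
  rw [sum_finrank_eq hp hp3 h0 h1 hL0 hfin1]
  have hrk : cmTypeRank (Ψ 1) = p / 2 + 1 := by
    rw [← cmTypeRank_inducedCMType (algebraMap (L 1) (K 1)) (Ψ 1), hind 1,
      cmTypeRank_eq_of_level_fourMulPrime hp (by omega) h1 (Φ 1) (hΦ 1), if_neg (by omega)]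
  have hle := CMAlgebra.cmTypeRank_le_cmFamilyRank Ψ 1
  omega

end Data

/-! ## §3 The Weil fibre `T_a = {(i, s) : s(a_i) = i}` satisfies Pohlmann's condition: `ℚ(i)` acts with multiplicities `((p+1)/4, (p+1)/4)` -/

section Balanced

variable {lev : Fin 2 → ℕ} [∀ i, NeZero (lev i)] {K : Fin 2 → Type} [∀ i, Field (K i)] [∀ i, NumberField (K i)]
  [∀ i, IsCyclotomicExtension {lev i} ℚ (K i)] {Φ : ∀ i, CMType (K i)}
  {L : ∀ i, IntermediateField ℚ (K i)} {Ψ : ∀ i, CMType (L i)} {p : ℕ}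

/-- **The slot counts**: for `c ∈ {i, −i}`, `#{x ∈ Ψ_0 : x(a_0) = c} + #{ρ ∈ Ψ_1 : ρ(a_1) = c} = (p+1)/4` (F49's Weil-type multiplicities, read on the
sub-pair family: the member `E_i` along `⊤ ≅ ℚ(ζ_4)`, index `1`). [cite: MoonenZarhin1999LowDim, §1 (1.9) and Introduction (a)]
[cite: GalleseGoodsonLombardo2024, §3.2 Lemma 11] -/
theorem sum_ncard_slots_eq (hp : p.Prime) (hp3 : p % 4 = 3) (h0 : lev 0 = 4) (h1 : lev 1 = 4 * p)
    (hΦ : ∀ i (σ : K i →+* ℂ), σ ∈ (Φ i).1 ↔ 2 * (expOf (lev i) (K i) σ).val < lev i)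
    (hind : ∀ i, inducedCMType (algebraMap (L i) (K i)) (Ψ i) = Φ i) (hL0 : L 0 = ⊤) (hfin1 : Module.finrank (L 1) (K 1) = 2)
    (a : ∀ i, 𝓞 (L i)) (ha : ∀ i, (((a i : L i)) : K i) = zetaOf (lev i) (K i) ^ ((![3, p] : Fin 2 → ℕ) i)) :
    (∑ i, {s : L i →+* ℂ | s ∈ (Ψ i).1 ∧ s (a i : L i) = Complex.I}.ncard) = (p + 1) / 4 ∧
      (∑ i, {s : L i →+* ℂ | s ∈ (Ψ i).1 ∧ s (a i : L i) = -Complex.I}.ncard) = (p + 1) / 4 := by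
  have hi : zetaOf (lev 1) (K 1) ^ p ∈ L 1 := by
    have h := (a 1 : L 1).2
    rw [show ((a 1 : L 1) : K 1) = zetaOf (lev 1) (K 1) ^ p from ha 1] at h
    exact h
  obtain ⟨c, hc2, hP, hM⟩ := weilType_multiplicities_cmCurve_oddSimpleFactor hp hp3 h0 h1 (Φ 0) (hΦ 0) (Φ 1) (hΦ 1) (hind 1) hfin1 hi
  -- slot 0 along `⊤`, index 1; slot 1: `a_1 = ⟨ζ^p, hi⟩`
  have hfin0 : Module.finrank (L 0) (K 0) = 1 := by rw [hL0, IntermediateField.finrank_top]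
  have e0 : ∀ c' : ℂ, {s : L 0 →+* ℂ | s ∈ (Ψ 0).1 ∧ s (a 0 : L 0) = c'}.ncard =
      {σ : K 0 →+* ℂ | σ ∈ (Φ 0).1 ∧ σ (zetaOf (lev 0) (K 0) ^ 3) = c'}.ncard := fun c' => by
    rw [show zetaOf (lev 0) (K 0) ^ 3 = ((a 0 : L 0) : K 0) from (ha 0).symm, ncard_restrict_eq_mul (hind 0) (a 0 : L 0) c', hfin0, one_mul]
  have e1 : ∀ c' : ℂ, {s : L 1 →+* ℂ | s ∈ (Ψ 1).1 ∧ s (a 1 : L 1) = c'}.ncard =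
      {ρ : L 1 →+* ℂ | ρ ∈ (Ψ 1).1 ∧ ρ ⟨_, hi⟩ = c'}.ncard := fun c' => by
    have hav : (a 1 : L 1) = ⟨_, hi⟩ := Subtype.ext (ha 1)
    rw [hav]
  have hcI : c = Complex.I ∨ c = -Complex.I := by
    apply sq_eq_sq_iff_eq_or_eq_neg.1
    rw [hc2, Complex.I_sq]
  rw [Fin.sum_univ_two, Fin.sum_univ_two, e0, e0, e1, e1]
  rcases hcI with rfl | rfl
  · exact ⟨hP, hM⟩
  · rw [neg_neg] at hM
    exact ⟨hM, hP⟩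

/-- **`#(T_a ∩ Σ) = (p+1)/4 = #(T_a ∖ Σ)`** for the Weil fibre `T_a = {(i,s) : s(a_i) = i}` of the family `(Ψ_0, Ψ_1)`: the two `ℚ(i)`-multiplicities of
`E_i × Y_{4p}` are equal (van Geemen 4.9: WEIL TYPE at the level of CM types; Moonen–Zarhin (1.9)). [cite: MoonenZarhin1999LowDim, §1 (1.9)]
[cite: vanGeemen1994HodgeAV, 4.9 and Lemma 5.2] -/
theorem ncard_weilFibre_sep_eq (hp : p.Prime) (hp3 : p % 4 = 3) (h0 : lev 0 = 4) (h1 : lev 1 = 4 * p)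
    (hΦ : ∀ i (σ : K i →+* ℂ), σ ∈ (Φ i).1 ↔ 2 * (expOf (lev i) (K i) σ).val < lev i)
    (hind : ∀ i, inducedCMType (algebraMap (L i) (K i)) (Ψ i) = Φ i) (hL0 : L 0 = ⊤) (hfin1 : Module.finrank (L 1) (K 1) = 2)
    (a : ∀ i, 𝓞 (L i)) (ha : ∀ i, (((a i : L i)) : K i) = zetaOf (lev i) (K i) ^ ((![3, p] : Fin 2 → ℕ) i)) :
    {x | x ∈ (Finset.univ.filter fun y : (i : Fin 2) × (L i →+* ℂ) => y.2 ((a y.1 : 𝓞 (L y.1)) : L y.1) = Complex.I) ∧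
        x.2 ∈ (Ψ x.1).1}.ncard = (p + 1) / 4 ∧
      {x | x ∈ (Finset.univ.filter fun y : (i : Fin 2) × (L i →+* ℂ) => y.2 ((a y.1 : 𝓞 (L y.1)) : L y.1) = -Complex.I) ∧
        x.2 ∈ (Ψ x.1).1}.ncard = (p + 1) / 4 := by
  obtain ⟨hI, hnI⟩ := sum_ncard_slots_eq hp hp3 h0 h1 hΦ hind hL0 hfin1 a ha
  have key : ∀ c : ℂ, {x | x ∈ (Finset.univ.filter fun y : (i : Fin 2) × (L i →+* ℂ) => y.2 ((a y.1 : 𝓞 (L y.1)) : L y.1) = c) ∧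
      x.2 ∈ (Ψ x.1).1}.ncard = ∑ i, {s : L i →+* ℂ | s ∈ (Ψ i).1 ∧ s (a i : L i) = c}.ncard := fun c => by
    rw [← ncard_sigma_eq_sum (F := fun i => L i) (fun i s => s ∈ (Ψ i).1 ∧ s (a i : L i) = c)]
    congr 1
    ext x
    simp only [Set.mem_setOf_eq, Finset.mem_filter, Finset.mem_univ, true_and]
    tauto
  exact ⟨by rw [key, hI], by rw [key, hnI]⟩

/-- **THE WEIL FIBRE `T_a` OF `E_i × Y_{4p}` SATISFIES POHLMANN'S CONDITION** (it is a Weil section — `Aut(ℂ)` moves it to itself or its conjugate,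
F51a `smul_weilFibre_eq_or` — and the one count balances, F51a `isGaloisBalancedAlg_of_smul_eq_or`): the Weil classes `W_{ℚ(i)} ⊂ H^{(p+1)/2}`
are Hodge classes (Deligne–Milne 4.4). [cite: Deligne1982HodgeCycles, §4 Prop. 4.4] [cite: MoonenZarhin1999LowDim, §1 (1.9)]
[cite: GaoUllmo2025, Thm. 3.1 (3.2)] -/
theorem isGaloisBalancedAlg_weilFibre (hp : p.Prime) (hp3 : p % 4 = 3) (h0 : lev 0 = 4) (h1 : lev 1 = 4 * p)
    (hΦ : ∀ i (σ : K i →+* ℂ), σ ∈ (Φ i).1 ↔ 2 * (expOf (lev i) (K i) σ).val < lev i)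
    (hind : ∀ i, inducedCMType (algebraMap (L i) (K i)) (Ψ i) = Φ i) (hL0 : L 0 = ⊤) (hfin1 : Module.finrank (L 1) (K 1) = 2)
    (a : ∀ i, 𝓞 (L i)) (ha : ∀ i, (((a i : L i)) : K i) = zetaOf (lev i) (K i) ^ ((![3, p] : Fin 2 → ℕ) i)) :
    IsGaloisBalancedAlg Ψ (Finset.univ.filter fun y : (i : Fin 2) × (L i →+* ℂ) =>
      y.2 ((a y.1 : 𝓞 (L y.1)) : L y.1) = Complex.I * (Real.sqrt ((1 : ℕ) : ℝ) : ℂ)) := by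
  haveI : ∀ i, IsCMField (L i) := isCMField_subPair (two_lt_lev hp h0 h1) Ψ
  have ha2 := sq_a_eq hp h0 h1 a ha
  obtain ⟨hI, hnI⟩ := ncard_weilFibre_sep_eq hp hp3 h0 h1 hΦ hind hL0 hfin1 a ha
  refine CMAlgebra.CorankOne.isGaloisBalancedAlg_of_smul_eq_or Ψ (CMAlgebra.CorankOne.smul_weilFibre_eq_or a one_pos ha2) ?_
  -- `#(T ∖ Σ) = #(T̄ ∩ Σ)` and `T̄` is the fibre of `−i`
  have h2 := ncard_sep_conj_smul_mem Ψ (1 : ℂ ≃+* ℂ)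
    (Finset.univ.filter fun y : (i : Fin 2) × (L i →+* ℂ) => y.2 ((a y.1 : 𝓞 (L y.1)) : L y.1) = Complex.I * (Real.sqrt ((1 : ℕ) : ℝ) : ℂ))
  have hone : ∀ x : (i : Fin 2) × (L i →+* ℂ), ((1 : ℂ ≃+* ℂ) : ℂ →+* ℂ).comp x.2 = x.2 := fun x => RingHom.ext fun _ => rfl
  simp only [hone] at h2
  have hconj : {x | x ∈ (starRingAut : ℂ ≃+* ℂ) • (Finset.univ.filter fun y : (i : Fin 2) × (L i →+* ℂ) =>
      y.2 ((a y.1 : 𝓞 (L y.1)) : L y.1) = Complex.I * (Real.sqrt ((1 : ℕ) : ℝ) : ℂ)) ∧ x.2 ∈ (Ψ x.1).1}.ncard =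
      {x | x ∈ (Finset.univ.filter fun y : (i : Fin 2) × (L i →+* ℂ) => y.2 ((a y.1 : 𝓞 (L y.1)) : L y.1) = -Complex.I) ∧
        x.2 ∈ (Ψ x.1).1}.ncard := by
    congr 1
    ext x
    simp only [Set.mem_setOf_eq]
    rw [CMAlgebra.CorankOne.mem_conj_smul_weilFibre_iff a one_pos ha2 x]
    simp only [Finset.mem_filter, Finset.mem_univ, true_and, I_mul_sqrt_one]
  have hA : {x | x ∈ (Finset.univ.filter fun y : (i : Fin 2) × (L i →+* ℂ) =>
      y.2 ((a y.1 : 𝓞 (L y.1)) : L y.1) = Complex.I * (Real.sqrt ((1 : ℕ) : ℝ) : ℂ)) ∧ x.2 ∈ (Ψ x.1).1}.ncard = (p + 1) / 4 := by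
    rw [← hI]
    congr 1
    ext x
    simp only [Set.mem_setOf_eq, Finset.mem_filter, Finset.mem_univ, true_and, I_mul_sqrt_one]
  rw [hA, ← h2, hconj, hnI]

end Balanced


/-! ## §4 The Weil fibre is NOT a divisor weight (F44's exceptional weight on the sub-pair is `T_a` or `T̄_a`) -/

section NotDivisor

variable {lev : Fin 2 → ℕ} [∀ i, NeZero (lev i)] {K : Fin 2 → Type} [∀ i, Field (K i)] [∀ i, NumberField (K i)]
  [∀ i, IsCyclotomicExtension {lev i} ℚ (K i)] {Φ : ∀ i, CMType (K i)}
  {L : ∀ i, IntermediateField ℚ (K i)} {Ψ : ∀ i, CMType (L i)} {p : ℕ}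

/-- F44's exceptional weight descends to the sub-pair family: `pohlmannSetsAlg Ψ ((p+1)/4) ∖ pohlmannDivisorSetsAlg Ψ ((p+1)/4) ≠ ∅`.
[cite: GalleseGoodsonLombardo2024, §3 Thm. 3.0 (5) and §3.2 Lemma 12] [cite: GaoUllmo2025, Thm. 3.1] -/
theorem pohlmannSetsAlg_diff_nonempty (hp : p.Prime) (hp3 : p % 4 = 3) (hp7 : 7 ≤ p) (h0 : lev 0 = 4) (h1 : lev 1 = 4 * p)
    (hΦ : ∀ i (σ : K i →+* ℂ), σ ∈ (Φ i).1 ↔ 2 * (expOf (lev i) (K i) σ).val < lev i)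
    (hind : ∀ i, inducedCMType (algebraMap (L i) (K i)) (Ψ i) = Φ i) (hL0 : L 0 = ⊤)
    (hζ1 : zetaOf (lev 1) (K 1) - (zetaOf (lev 1) (K 1))⁻¹ ∈ L 1) :
    (pohlmannSetsAlg Ψ ((p + 1) / 4) \ pohlmannDivisorSetsAlg Ψ ((p + 1) / 4)).Nonempty := by
  haveI : NeZero p := ⟨hp.ne_zero⟩
  haveI : NeZero (4 * p) := ⟨by have := hp.pos; omega⟩
  have hdvd : ∀ i, lev i ∣ 4 * p := Fin.forall_fin_two.2 ⟨⟨p, h0 ▸ rfl⟩, by rw [h1]⟩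
  have hW := weight_four_fourMulPrime_mem_pohlmannSetsAlg_diff (lev := lev) (K := K) (Φ := Φ) hp hp3 (by omega) hdvd (i₀ := 0) (i₁ := 1)
    h0 h1 hΦ
  have hinj := injOn_restrict_weight_four_fourMulPrime (lev := lev) (K := K) (L := L) hp (i₀ := 0) (i₁ := 1) Fin.zero_ne_one h1 hL0 hζ1
  exact diff_nonempty_subPair_of_injOn hind hW hinj

/-- **`T_a ∉ pohlmannDivisorSetsAlg`**: by F51a's classification the exceptional weight of §4 is `T_a` or `T̄_a`, and `T̄_a` divisorial would make `T_a`
divisorial. [cite: MoonenZarhin1999LowDim, Thm. 0.1 (1)] [cite: Gordon1999HodgeAVSurvey, 9.2.2] -/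
theorem weilFibre_not_mem_pohlmannDivisorSetsAlg (hp : p.Prime) (hp3 : p % 4 = 3) (hp7 : 7 ≤ p) (h0 : lev 0 = 4) (h1 : lev 1 = 4 * p)
    (hΦ : ∀ i (σ : K i →+* ℂ), σ ∈ (Φ i).1 ↔ 2 * (expOf (lev i) (K i) σ).val < lev i)
    (hind : ∀ i, inducedCMType (algebraMap (L i) (K i)) (Ψ i) = Φ i) (hL0 : L 0 = ⊤) (hfin1 : Module.finrank (L 1) (K 1) = 2)
    (hζ1 : zetaOf (lev 1) (K 1) - (zetaOf (lev 1) (K 1))⁻¹ ∈ L 1)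
    (a : ∀ i, 𝓞 (L i)) (ha : ∀ i, (((a i : L i)) : K i) = zetaOf (lev i) (K i) ^ ((![3, p] : Fin 2 → ℕ) i)) :
    (Finset.univ.filter fun y : (i : Fin 2) × (L i →+* ℂ) =>
        y.2 ((a y.1 : 𝓞 (L y.1)) : L y.1) = Complex.I * (Real.sqrt ((1 : ℕ) : ℝ) : ℂ)) ∉ pohlmannDivisorSetsAlg Ψ ((p + 1) / 4) := by
  haveI : ∀ i, IsCMField (L i) := isCMField_subPair (two_lt_lev hp h0 h1) Ψ
  have ha2 := sq_a_eq hp h0 h1 a ha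
  have hrank := le_cmFamilyRank hp hp3 h0 h1 hΦ hind hL0 hfin1
  have hT := CMAlgebra.CorankOne.mem_weilFibre_iff_conj_smul_not_mem a one_pos ha2
  have hTbal := isGaloisBalancedAlg_weilFibre hp hp3 h0 h1 hΦ hind hL0 hfin1 a ha
  intro hD
  obtain ⟨S, hS, hSD⟩ := pohlmannSetsAlg_diff_nonempty hp hp3 hp7 h0 h1 hΦ hind hL0 hζ1
  rcases CMAlgebra.CorankOne.mem_pohlmannDivisorSetsAlg_or_eq_or_eq_conj_smul hrank hT hTbal hS with h | rfl | rfl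
  · exact hSD h
  · exact hSD hD
  · exact hSD (CMAlgebra.CorankOne.smul_mem_pohlmannDivisorSetsAlg _ hD)

end NotDivisor

/-! ## §5 The Hodge ring of `E_i ⊕ Y_{4p}`: `B• = D• ⊕ W_{ℚ(i)}`, Weil type, and the Hodge conjecture as the algebraicity of one plane -/

section HodgeRing

variable {lev : Fin 2 → ℕ} [∀ i, NeZero (lev i)] {K : Fin 2 → Type} [∀ i, Field (K i)] [∀ i, NumberField (K i)]
  [∀ i, IsCyclotomicExtension {lev i} ℚ (K i)] {Φ : ∀ i, CMType (K i)}
  {L : ∀ i, IntermediateField ℚ (K i)} {Ψ : ∀ i, CMType (L i)}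
  {B : Fin 2 → AbelianVariety ℂ} {ιB : ∀ i, 𝓞 (L i) →+* End (B i)} {θB : ∀ i, L i →+* Module.End ℂ (complexBetti (B i).X 1)} {p : ℕ}

/-- `4 · (p+1)/4 = p + 1 = Σ_i [L_i:ℚ]` and `(p+1)/4 ≥ 1`. [folklore] -/
private theorem four_mul_eq (hp : p.Prime) (hp3 : p % 4 = 3) (h0 : lev 0 = 4) (h1 : lev 1 = 4 * p) (hL0 : L 0 = ⊤)
    (hfin1 : Module.finrank (L 1) (K 1) = 2) : 4 * ((p + 1) / 4) = ∑ i, finrank ℚ (L i) ∧ 0 < (p + 1) / 4 := by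
  rw [sum_finrank_eq hp hp3 h0 h1 hL0 hfin1]
  have := hp.two_le
  omega

/-- **`B^q(E_i ⊕ Y_{4p}) ⊗ ℂ = D^q ⊗ ℂ` OFF THE MIDDLE DEGREE** (`4q ≠ p + 1`): van Geemen 6.12 «`Bᵖ = Dᵖ` for `p ≠ n`» for this family.
[cite: vanGeemen1994HodgeAV, Thm. 6.12] [cite: MoonenZarhin1999LowDim, Thm. 0.1 (1)] [cite: GaoUllmo2025, Thm. 3.1] -/
theorem hodgeClassSpan_eq_divisorClassesSpan_of_ne (hp : p.Prime) (hp3 : p % 4 = 3) (h0 : lev 0 = 4) (h1 : lev 1 = 4 * p)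
    (hΦ : ∀ i (σ : K i →+* ℂ), σ ∈ (Φ i).1 ↔ 2 * (expOf (lev i) (K i) σ).val < lev i)
    (hind : ∀ i, inducedCMType (algebraMap (L i) (K i)) (Ψ i) = Φ i) (hL0 : L 0 = ⊤) (hfin1 : Module.finrank (L 1) (K 1) = 2)
    (a : ∀ i, 𝓞 (L i)) (ha : ∀ i, (((a i : L i)) : K i) = zetaOf (lev i) (K i) ^ ((![3, p] : Fin 2 → ℕ) i))
    (hB : ∀ i, IsCMTypeRealisation (Ψ i) (B i) (ιB i) (θB i)) {q : ℕ} (hq : 4 * q ≠ p + 1) :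
    hodgeClassSpan (⨁ B).dim (⨁ B).X q = divisorClassesSpan (⨁ B).X (⨁ B).dim q := by
  haveI : ∀ i, IsCMField (L i) := isCMField_subPair (two_lt_lev hp h0 h1) Ψ
  have ha2 := sq_a_eq hp h0 h1 a ha
  exact CMAlgebra.CorankOne.hodgeClassSpan_eq_divisorClassesSpan_of_ne (le_cmFamilyRank hp hp3 h0 h1 hΦ hind hL0 hfin1)
    (CMAlgebra.CorankOne.mem_weilFibre_iff_conj_smul_not_mem a one_pos ha2)
    (isGaloisBalancedAlg_weilFibre hp hp3 h0 h1 hΦ hind hL0 hfin1 a ha) hB (by rwa [sum_finrank_eq hp hp3 h0 h1 hL0 hfin1])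

/-- **`(E_i ⊕ Y_{4p}, ι(ζ_4³) ⊕ ι(ζ_{4p}^p))` IS OF WEIL TYPE `((p+1)/4, 1)`** — the Hodge-structure statement: `φ = ι_0(a_0) ⊕ ι_1(a_1)` has `φ² = −1` and
`i` is an eigenvalue of `φ^*` on `H^{1,0}` of multiplicity `(p+1)/4 = dim/2` (F51a `isWeilType`; F49 had this at the level of CM types only).
[cite: vanGeemen1994HodgeAV, 4.9 and Lemma 5.2] [cite: MoonenZarhin1999LowDim, §1 (1.9)] [cite: Deligne1982HodgeCycles, §4 Prop. 4.4] -/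
theorem isWeilType (hp : p.Prime) (hp3 : p % 4 = 3) (h0 : lev 0 = 4) (h1 : lev 1 = 4 * p)
    (hΦ : ∀ i (σ : K i →+* ℂ), σ ∈ (Φ i).1 ↔ 2 * (expOf (lev i) (K i) σ).val < lev i)
    (hind : ∀ i, inducedCMType (algebraMap (L i) (K i)) (Ψ i) = Φ i) (hL0 : L 0 = ⊤) (hfin1 : Module.finrank (L 1) (K 1) = 2)
    (a : ∀ i, 𝓞 (L i)) (ha : ∀ i, (((a i : L i)) : K i) = zetaOf (lev i) (K i) ^ ((![3, p] : Fin 2 → ℕ) i))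
    (hB : ∀ i, IsCMTypeRealisation (Ψ i) (B i) (ιB i) (θB i)) :
    IsWeilType (⨁ B) (biproduct.map fun i => ιB i (a i)) ((p + 1) / 4) 1 := by
  haveI : ∀ i, IsCMField (L i) := isCMField_subPair (two_lt_lev hp h0 h1) Ψ
  have ha2 := sq_a_eq hp h0 h1 a ha
  obtain ⟨hm4, hm⟩ := four_mul_eq hp hp3 h0 h1 hL0 hfin1
  exact CMAlgebra.CorankOne.isWeilType hB a one_pos ha2 hm hm4 (isGaloisBalancedAlg_weilFibre hp hp3 h0 h1 hΦ hind hL0 hfin1 a ha)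

/-- **`B^m(E_i ⊕ Y_{4p}) ⊗ ℂ = D^m ⊗ ℂ ⊔ W_{ℚ(i)} ⊗ ℂ` IN THE MIDDLE DEGREE `m = (p+1)/4`** — Moonen–Zarhin's Thm. 0.1 (1) «`B•(X)` is generated by
`D•(X)` together with the space of Weil classes `W_k`» for `X = E_i × Y_{28}` (`p = 7`), and its analogue for the whole family (`W_k ⊗ ℂ =
weilClassesOf (⨁ B) (ι_0(a_0) ⊕ ι_1(a_1)) m 1`). [cite: MoonenZarhin1999LowDim, Thm. 0.1 (1)] [cite: vanGeemen1994HodgeAV, Thm. 6.12 and 4.9]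
[cite: GaoUllmo2025, Thm. 3.1] -/
theorem hodgeClassSpan_eq_divisorClassesSpan_sup_weilClassesOf (hp : p.Prime) (hp3 : p % 4 = 3) (hp7 : 7 ≤ p) (h0 : lev 0 = 4)
    (h1 : lev 1 = 4 * p) (hΦ : ∀ i (σ : K i →+* ℂ), σ ∈ (Φ i).1 ↔ 2 * (expOf (lev i) (K i) σ).val < lev i)
    (hind : ∀ i, inducedCMType (algebraMap (L i) (K i)) (Ψ i) = Φ i) (hL0 : L 0 = ⊤) (hfin1 : Module.finrank (L 1) (K 1) = 2)
    (a : ∀ i, 𝓞 (L i)) (ha : ∀ i, (((a i : L i)) : K i) = zetaOf (lev i) (K i) ^ ((![3, p] : Fin 2 → ℕ) i))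
    (hB : ∀ i, IsCMTypeRealisation (Ψ i) (B i) (ιB i) (θB i)) :
    hodgeClassSpan (⨁ B).dim (⨁ B).X ((p + 1) / 4) =
      divisorClassesSpan (⨁ B).X (⨁ B).dim ((p + 1) / 4) ⊔ weilClassesOf (⨁ B) (biproduct.map fun i => ιB i (a i)) ((p + 1) / 4) 1 := by
  haveI : ∀ i, IsCMField (L i) := isCMField_subPair (two_lt_lev hp h0 h1) Ψ
  have ha2 := sq_a_eq hp h0 h1 a ha
  obtain ⟨hm4, hm⟩ := four_mul_eq hp hp3 h0 h1 hL0 hfin1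
  have := hp7
  exact CMAlgebra.CorankOne.hodgeClassSpan_eq_divisorClassesSpan_sup_weilClassesOf (le_cmFamilyRank hp hp3 h0 h1 hΦ hind hL0 hfin1) hB a
    one_pos ha2 hm hm4 (isGaloisBalancedAlg_weilFibre hp hp3 h0 h1 hΦ hind hL0 hfin1 a ha)

/-- **The exceptional weights of `E_i ⊕ Y_{4p}` are EXACTLY `T_a` and `T̄_a`** (middle degree; none elsewhere). [cite: MoonenZarhin1999LowDim, Thm. 0.1 (1)]
[cite: Gordon1999HodgeAVSurvey, 9.2.2 and 9.5] -/
theorem mem_pohlmannSetsAlg_diff_iff (hp : p.Prime) (hp3 : p % 4 = 3) (hp7 : 7 ≤ p) (h0 : lev 0 = 4) (h1 : lev 1 = 4 * p)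
    (hΦ : ∀ i (σ : K i →+* ℂ), σ ∈ (Φ i).1 ↔ 2 * (expOf (lev i) (K i) σ).val < lev i)
    (hind : ∀ i, inducedCMType (algebraMap (L i) (K i)) (Ψ i) = Φ i) (hL0 : L 0 = ⊤) (hfin1 : Module.finrank (L 1) (K 1) = 2)
    (hζ1 : zetaOf (lev 1) (K 1) - (zetaOf (lev 1) (K 1))⁻¹ ∈ L 1)
    (a : ∀ i, 𝓞 (L i)) (ha : ∀ i, (((a i : L i)) : K i) = zetaOf (lev i) (K i) ^ ((![3, p] : Fin 2 → ℕ) i))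
    (S : Finset ((i : Fin 2) × (L i →+* ℂ))) :
    S ∈ pohlmannSetsAlg Ψ ((p + 1) / 4) \ pohlmannDivisorSetsAlg Ψ ((p + 1) / 4) ↔
      S = (Finset.univ.filter fun y : (i : Fin 2) × (L i →+* ℂ) =>
          y.2 ((a y.1 : 𝓞 (L y.1)) : L y.1) = Complex.I * (Real.sqrt ((1 : ℕ) : ℝ) : ℂ)) ∨
        S = (starRingAut : ℂ ≃+* ℂ) • (Finset.univ.filter fun y : (i : Fin 2) × (L i →+* ℂ) =>
          y.2 ((a y.1 : 𝓞 (L y.1)) : L y.1) = Complex.I * (Real.sqrt ((1 : ℕ) : ℝ) : ℂ)) := by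
  haveI : ∀ i, IsCMField (L i) := isCMField_subPair (two_lt_lev hp h0 h1) Ψ
  have ha2 := sq_a_eq hp h0 h1 a ha
  obtain ⟨hm4, -⟩ := four_mul_eq hp hp3 h0 h1 hL0 hfin1
  have hT := CMAlgebra.CorankOne.mem_weilFibre_iff_conj_smul_not_mem a one_pos ha2
  have hcard := CMAlgebra.CorankOne.two_mul_card_eq_sum_finrank hT
  exact CMAlgebra.CorankOne.mem_pohlmannSetsAlg_diff_iff (le_cmFamilyRank hp hp3 h0 h1 hΦ hind hL0 hfin1) hT
    ⟨by omega, isGaloisBalancedAlg_weilFibre hp hp3 h0 h1 hΦ hind hL0 hfin1 a ha⟩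
    (weilFibre_not_mem_pohlmannDivisorSetsAlg hp hp3 hp7 h0 h1 hΦ hind hL0 hfin1 hζ1 a ha) S

/-- **EVERY EXCEPTIONAL WEIGHT LINE OF `E_i ⊕ Y_{4p}` — IN PARTICULAR F44's CLASS — LIES IN THE WEIL PLANE `W_{ℚ(i)} ⊗ ℂ`**: the located exceptional
Hodge classes of the `J_{4p}`-family on `E_i × Y_{4p}` ARE Weil classes. [cite: MoonenZarhin1999LowDim, Thm. 0.1 (1) and §1 (1.9)]
[cite: vanGeemen1994HodgeAV, 4.9 and proof of Thm. 6.12] -/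
theorem weightClassesAlg_le_weilClassesOf_of_mem_diff (hp : p.Prime) (hp3 : p % 4 = 3) (hp7 : 7 ≤ p) (h0 : lev 0 = 4) (h1 : lev 1 = 4 * p)
    (hΦ : ∀ i (σ : K i →+* ℂ), σ ∈ (Φ i).1 ↔ 2 * (expOf (lev i) (K i) σ).val < lev i)
    (hind : ∀ i, inducedCMType (algebraMap (L i) (K i)) (Ψ i) = Φ i) (hL0 : L 0 = ⊤) (hfin1 : Module.finrank (L 1) (K 1) = 2)
    (hζ1 : zetaOf (lev 1) (K 1) - (zetaOf (lev 1) (K 1))⁻¹ ∈ L 1)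
    (a : ∀ i, 𝓞 (L i)) (ha : ∀ i, (((a i : L i)) : K i) = zetaOf (lev i) (K i) ^ ((![3, p] : Fin 2 → ℕ) i))
    {S : Finset ((i : Fin 2) × (L i →+* ℂ))} (hS : S ∈ pohlmannSetsAlg Ψ ((p + 1) / 4) \ pohlmannDivisorSetsAlg Ψ ((p + 1) / 4)) :
    weightClassesAlg B ιB (2 * ((p + 1) / 4)) S ≤ weilClassesOf (⨁ B) (biproduct.map fun i => ιB i (a i)) ((p + 1) / 4) 1 := by
  haveI : ∀ i, IsCMField (L i) := isCMField_subPair (two_lt_lev hp h0 h1) Ψ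
  have ha2 := sq_a_eq hp h0 h1 a ha
  obtain ⟨hm4, -⟩ := four_mul_eq hp hp3 h0 h1 hL0 hfin1
  have hT := CMAlgebra.CorankOne.mem_weilFibre_iff_conj_smul_not_mem a one_pos ha2
  have hcard := CMAlgebra.CorankOne.two_mul_card_eq_sum_finrank hT
  obtain ⟨hleP, hleM⟩ := CMAlgebra.CorankOne.weightClassesAlg_weilFibre_le (A := B) (ι := ιB) a one_pos ha2 (m := (p + 1) / 4) (by omega)
  rcases (mem_pohlmannSetsAlg_diff_iff hp hp3 hp7 h0 h1 hΦ hind hL0 hfin1 hζ1 a ha S).1 hS with rfl | rfl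
  · exact hleP
  · exact hleM

/-- **`dim B^m(E_i ⊕ Y_{4p}) = dim D^m + 2`**: exactly two exceptional weights. [cite: MoonenZarhin1999LowDim, Thm. 0.1 (1)] [cite: Gordon1999HodgeAVSurvey, 5.13 (ii)] -/
theorem ncard_pohlmannSetsAlg_diff_eq_two (hp : p.Prime) (hp3 : p % 4 = 3) (hp7 : 7 ≤ p) (h0 : lev 0 = 4) (h1 : lev 1 = 4 * p)
    (hΦ : ∀ i (σ : K i →+* ℂ), σ ∈ (Φ i).1 ↔ 2 * (expOf (lev i) (K i) σ).val < lev i)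
    (hind : ∀ i, inducedCMType (algebraMap (L i) (K i)) (Ψ i) = Φ i) (hL0 : L 0 = ⊤) (hfin1 : Module.finrank (L 1) (K 1) = 2)
    (hζ1 : zetaOf (lev 1) (K 1) - (zetaOf (lev 1) (K 1))⁻¹ ∈ L 1)
    (a : ∀ i, 𝓞 (L i)) (ha : ∀ i, (((a i : L i)) : K i) = zetaOf (lev i) (K i) ^ ((![3, p] : Fin 2 → ℕ) i)) :
    (pohlmannSetsAlg Ψ ((p + 1) / 4) \ pohlmannDivisorSetsAlg Ψ ((p + 1) / 4)).ncard = 2 := by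
  haveI : ∀ i, IsCMField (L i) := isCMField_subPair (two_lt_lev hp h0 h1) Ψ
  have ha2 := sq_a_eq hp h0 h1 a ha
  obtain ⟨hm4, hm⟩ := four_mul_eq hp hp3 h0 h1 hL0 hfin1
  have hT := CMAlgebra.CorankOne.mem_weilFibre_iff_conj_smul_not_mem a one_pos ha2
  have hcard := CMAlgebra.CorankOne.two_mul_card_eq_sum_finrank hT
  exact CMAlgebra.CorankOne.ncard_pohlmannSetsAlg_diff_eq_two (le_cmFamilyRank hp hp3 h0 h1 hΦ hind hL0 hfin1) hT hm
    ⟨by omega, isGaloisBalancedAlg_weilFibre hp hp3 h0 h1 hΦ hind hL0 hfin1 a ha⟩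
    (weilFibre_not_mem_pohlmannDivisorSetsAlg hp hp3 hp7 h0 h1 hΦ hind hL0 hfin1 hζ1 a ha)

/-- **The Hodge classes of `E_i ⊕ Y_{4p}` are generated by divisors and the one Weil plane** (`IsDivisorWeilGenerated`).
[cite: vanGeemen1994HodgeAV, Thm. 6.12] [cite: MoonenZarhin1999LowDim, Thm. 0.1 (1)] -/
theorem isDivisorWeilGenerated (hp : p.Prime) (hp3 : p % 4 = 3) (h0 : lev 0 = 4) (h1 : lev 1 = 4 * p)
    (hΦ : ∀ i (σ : K i →+* ℂ), σ ∈ (Φ i).1 ↔ 2 * (expOf (lev i) (K i) σ).val < lev i)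
    (hind : ∀ i, inducedCMType (algebraMap (L i) (K i)) (Ψ i) = Φ i) (hL0 : L 0 = ⊤) (hfin1 : Module.finrank (L 1) (K 1) = 2)
    (a : ∀ i, 𝓞 (L i)) (ha : ∀ i, (((a i : L i)) : K i) = zetaOf (lev i) (K i) ^ ((![3, p] : Fin 2 → ℕ) i))
    (hB : ∀ i, IsCMTypeRealisation (Ψ i) (B i) (ιB i) (θB i)) :
    IsDivisorWeilGenerated (⨁ B) (biproduct.map fun i => ιB i (a i)) ((p + 1) / 4) 1 := by
  haveI : ∀ i, IsCMField (L i) := isCMField_subPair (two_lt_lev hp h0 h1) Ψ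
  have ha2 := sq_a_eq hp h0 h1 a ha
  obtain ⟨hm4, hm⟩ := four_mul_eq hp hp3 h0 h1 hL0 hfin1
  exact CMAlgebra.CorankOne.isDivisorWeilGenerated (le_cmFamilyRank hp hp3 h0 h1 hΦ hind hL0 hfin1) hB a one_pos ha2 hm hm4
    (isGaloisBalancedAlg_weilFibre hp hp3 h0 h1 hΦ hind hL0 hfin1 a ha)

/-- **THE HODGE CONJECTURE FOR `E_i ⊕ Y_{4p}` IS EQUIVALENT TO THE ALGEBRAICITY OF THE RATIONAL `(m,m)` WEIL CLASSES OF `ι(ζ_4³) ⊕ ι(ζ_{4p}^p)`**,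
`m = (p+1)/4` — Weil's question (van Geemen 1.1) for ONE abelian variety of Weil type `(m, 1)` and dimension `2m = (p+1)/2`.
[cite: vanGeemen1994HodgeAV, 1.1, Thm. 4.11 and Thm. 6.12] [cite: MoonenZarhin1999LowDim, Thm. 0.1 (1)] [cite: Gordon1999HodgeAVSurvey, 9.5] -/
theorem hodgeConjectureFor_iff_weilClasses_algebraic (hp : p.Prime) (hp3 : p % 4 = 3) (h0 : lev 0 = 4) (h1 : lev 1 = 4 * p)
    (hΦ : ∀ i (σ : K i →+* ℂ), σ ∈ (Φ i).1 ↔ 2 * (expOf (lev i) (K i) σ).val < lev i)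
    (hind : ∀ i, inducedCMType (algebraMap (L i) (K i)) (Ψ i) = Φ i) (hL0 : L 0 = ⊤) (hfin1 : Module.finrank (L 1) (K 1) = 2)
    (a : ∀ i, 𝓞 (L i)) (ha : ∀ i, (((a i : L i)) : K i) = zetaOf (lev i) (K i) ^ ((![3, p] : Fin 2 → ℕ) i))
    (hB : ∀ i, IsCMTypeRealisation (Ψ i) (B i) (ιB i) (θB i)) :
    HodgeConjectureFor (⨁ B).dim (⨁ B).X ↔
      ∀ c ∈ weilClassesOf (⨁ B) (biproduct.map fun i => ιB i (a i)) ((p + 1) / 4) 1, IsRationalClass c →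
        IsOfHodgeType (2 * ((p + 1) / 4)) (⨁ B).X (2 * ((p + 1) / 4)) ((p + 1) / 4) ((p + 1) / 4) c →
          c ∈ algebraicClasses (⨁ B).X ((p + 1) / 4) := by
  haveI : ∀ i, IsCMField (L i) := isCMField_subPair (two_lt_lev hp h0 h1) Ψ
  have ha2 := sq_a_eq hp h0 h1 a ha
  obtain ⟨hm4, hm⟩ := four_mul_eq hp hp3 h0 h1 hL0 hfin1
  exact CMAlgebra.CorankOne.hodgeConjectureFor_iff_weilClasses_algebraic (le_cmFamilyRank hp hp3 h0 h1 hΦ hind hL0 hfin1) hB a one_pos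
    ha2 hm hm4 (isGaloisBalancedAlg_weilFibre hp hp3 h0 h1 hΦ hind hL0 hfin1 a ha)

/-- **The product form**: the Hodge conjecture for `E_i × Y_{4p} = B_0 × B_1` from the algebraicity of the Weil plane of
`(B_0 × B_1, ι_0(a_0) × ι_1(a_1))`. [cite: MoonenZarhin1999LowDim, Thm. 0.1 (a) and (1)] [cite: vanGeemen1994HodgeAV, 3.6–3.7] -/
theorem hodgeConjectureFor_prod_of_weilClasses_algebraic (hp : p.Prime) (hp3 : p % 4 = 3) (h0 : lev 0 = 4) (h1 : lev 1 = 4 * p)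
    (hΦ : ∀ i (σ : K i →+* ℂ), σ ∈ (Φ i).1 ↔ 2 * (expOf (lev i) (K i) σ).val < lev i)
    (hind : ∀ i, inducedCMType (algebraMap (L i) (K i)) (Ψ i) = Φ i) (hL0 : L 0 = ⊤) (hfin1 : Module.finrank (L 1) (K 1) = 2)
    (a : ∀ i, 𝓞 (L i)) (ha : ∀ i, (((a i : L i)) : K i) = zetaOf (lev i) (K i) ^ ((![3, p] : Fin 2 → ℕ) i))
    (hB : ∀ i, IsCMTypeRealisation (Ψ i) (B i) (ιB i) (θB i))
    (hW : weilClassesOf ((B 0).prod (B 1))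
        (AbelianVariety.prodLift (AbelianVariety.fst (B 0) (B 1) ≫ ιB 0 (a 0)) (AbelianVariety.snd (B 0) (B 1) ≫ ιB 1 (a 1)))
        ((p + 1) / 4) 1 ≤ algebraicClasses ((B 0).prod (B 1)).X ((p + 1) / 4)) :
    HodgeConjectureFor ((B 0).prod (B 1)).dim ((B 0).prod (B 1)).X := by
  haveI : ∀ i, IsCMField (L i) := isCMField_subPair (two_lt_lev hp h0 h1) Ψ
  have ha2 := sq_a_eq hp h0 h1 a ha
  obtain ⟨hm4, hm⟩ := four_mul_eq hp hp3 h0 h1 hL0 hfin1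
  exact CMAlgebra.CorankOne.hodgeConjectureFor_prod_of_weilClasses_algebraic (le_cmFamilyRank hp hp3 h0 h1 hΦ hind hL0 hfin1) hB a one_pos
    ha2 hm hm4 (isGaloisBalancedAlg_weilFibre hp hp3 h0 h1 hΦ hind hL0 hfin1 a ha) hW

end HodgeRing

/-! ## §6 `p = 7`: the Hodge conjecture for `E_i × Y_{28}` from Markman's theorem on abelian fourfolds of Weil type -/

section Seven

variable {lev : Fin 2 → ℕ} [∀ i, NeZero (lev i)] {K : Fin 2 → Type} [∀ i, Field (K i)] [∀ i, NumberField (K i)]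
  [∀ i, IsCyclotomicExtension {lev i} ℚ (K i)] {Φ : ∀ i, CMType (K i)}
  {L : ∀ i, IntermediateField ℚ (K i)} {Ψ : ∀ i, CMType (L i)}
  {B : Fin 2 → AbelianVariety ℂ} {ιB : ∀ i, 𝓞 (L i) →+* End (B i)} {θB : ∀ i, L i →+* Module.End ℂ (complexBetti (B i).X 1)}

/-- **`p = 7`, GIVEN MARKMAN'S THEOREM: THE HODGE CONJECTURE HOLDS FOR `E_i ⊕ Y_{28}` AND FOR `E_i × Y_{28}`** — Moonen–Zarhin's case (a)
fourfold inside `J_{28}`: `B² = D² ⊕ W_{ℚ(i)}` (§5) and the Weil classes of the fourfold `(E_i ⊕ Y_{28}, ι(ζ_4³) ⊕ ι(ζ_{28}^7))` of Weil type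
`(2, 1)` are algebraic by `Markman2025_weilClasses_algebraic_abelianFourfold` (a NAMED FACT of the tree, taken as the hypothesis `hMk`).  (The tree
already derives the Hodge conjecture for every complex abelian variety of CM type of dimension `≤ 4` from that fact; this is the explicit route through
ONE Weil plane.) [cite: Markman2025SurveySecant, Thm. 1.2 and §11.5 Step 2] [cite: MoonenZarhin1999LowDim, Thm. 0.1 (a) and (1)] -/
theorem hodgeConjectureFor_of_markman_seven (hMk : Markman2025_weilClasses_algebraic_abelianFourfold) (h0 : lev 0 = 4) (h1 : lev 1 = 4 * 7)
    (hΦ : ∀ i (σ : K i →+* ℂ), σ ∈ (Φ i).1 ↔ 2 * (expOf (lev i) (K i) σ).val < lev i)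
    (hind : ∀ i, inducedCMType (algebraMap (L i) (K i)) (Ψ i) = Φ i) (hL0 : L 0 = ⊤) (hfin1 : Module.finrank (L 1) (K 1) = 2)
    (a : ∀ i, 𝓞 (L i)) (ha : ∀ i, (((a i : L i)) : K i) = zetaOf (lev i) (K i) ^ ((![3, 7] : Fin 2 → ℕ) i))
    (hB : ∀ i, IsCMTypeRealisation (Ψ i) (B i) (ιB i) (θB i)) :
    HodgeConjectureFor (⨁ B).dim (⨁ B).X ∧ HodgeConjectureFor ((B 0).prod (B 1)).dim ((B 0).prod (B 1)).X := by
  have hp : (7 : ℕ).Prime := by norm_num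
  haveI : ∀ i, IsCMField (L i) := isCMField_subPair (two_lt_lev hp h0 h1) Ψ
  have ha2 := sq_a_eq hp h0 h1 a ha
  have hWT := isWeilType hp rfl h0 h1 hΦ hind hL0 hfin1 a ha hB
  have hdim : (⨁ B).dim = 2 * 2 := hWT.dim_eq
  have hφ : (biproduct.map fun i => ιB i (a i)) ≫ (biproduct.map fun i => ιB i (a i)) = -((1 : ℕ) • 𝟙 (⨁ B)) :=
    biproduct_map_comp_self_eq_neg a ha2
  have hX : IsSmoothProjective (2 * 2) (⨁ B).X := hdim ▸ Motives.AbelianVariety.isSmoothProjective_holds (A := ⨁ B)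
  have hHC : HodgeConjectureFor (⨁ B).dim (⨁ B).X :=
    (hodgeConjectureFor_iff_weilClasses_algebraic hp rfl h0 h1 hΦ hind hL0 hfin1 a ha hB).2 fun c hc hcQ hcH =>
      hMk 1 one_pos (⨁ B) _ hdim hX hφ c hcQ hcH hc
  exact ⟨hHC, hodgeConjectureFor_prod_of_biproduct hHC⟩

end Seven

/-! ## §7 From realisations `E_i ⊨ (ℚ(ζ_4); Φ_4)`, `X_{4p} ⊨ (ℚ(ζ_{4p}); Φ_{4p})`: the data exist; the hypothesis-free family statement -/

section Existence

variable {lev : Fin 2 → ℕ} [∀ i, NeZero (lev i)] {K : Fin 2 → Type} [∀ i, Field (K i)] [∀ i, NumberField (K i)]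
  [∀ i, IsCyclotomicExtension {lev i} ℚ (K i)] {Φ : ∀ i, CMType (K i)} {A : Fin 2 → AbelianVariety ℂ}
  {ι : ∀ i, 𝓞 (K i) →+* End (A i)} {θ : ∀ i, K i →+* Module.End ℂ (complexBetti (A i).X 1)} {p : ℕ}

/-- **The data of §2–§6 exist for every pair of realisations `A_0 ⊨ (ℚ(ζ_4); Φ_4)`, `A_1 ⊨ (ℚ(ζ_{4p}); Φ_{4p})`** (`p ≡ 3 (mod 4)`, `p ≥ 7`): the member
`E_i = A_0` kept whole (F44 `exists_top_subPair`), the simple factor `Y_{4p} = B_1` of `A_1 ∼ B_1²` with its sub-pair `(ℚ(ζ − ζ^{−1}); Ψ_1)` of index `2`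
(F42 `exists_simpleFactor_retract`), and `a = (ζ_4³, ζ_{4p}^p) ∈ ∏ 𝓞_{L_i}` (F44 §5: `ζ^p ∈ ℚ(ζ − ζ^{−1})`).
[cite: GalleseGoodsonLombardo2024, §3 Thm. 3.0 (5) and §3.2 Lemma 11] [cite: Shimura1998, §6.2 Thm. 3 and §8.2 Prop. 26] -/
theorem exists_data (hp : p.Prime) (hp7 : 7 ≤ p) (h0 : lev 0 = 4) (h1 : lev 1 = 4 * p)
    (hΦ : ∀ i (σ : K i →+* ℂ), σ ∈ (Φ i).1 ↔ 2 * (expOf (lev i) (K i) σ).val < lev i)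
    (hA : ∀ i, IsCMTypeRealisation (Φ i) (A i) (ι i) (θ i)) :
    ∃ (L : ∀ i, IntermediateField ℚ (K i)) (Ψ : ∀ i, CMType (L i)) (B : Fin 2 → AbelianVariety ℂ)
      (ιB : ∀ i, 𝓞 (L i) →+* End (B i)) (θB : ∀ i, L i →+* Module.End ℂ (complexBetti (B i).X 1)) (a : ∀ i, 𝓞 (L i)),
      (∀ i, inducedCMType (algebraMap (L i) (K i)) (Ψ i) = Φ i) ∧ (∀ i, IsCMTypeRealisation (Ψ i) (B i) (ιB i) (θB i)) ∧
      L 0 = ⊤ ∧ B 0 = A 0 ∧ Module.finrank (L 1) (K 1) = 2 ∧ zetaOf (lev 1) (K 1) - (zetaOf (lev 1) (K 1))⁻¹ ∈ L 1 ∧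
      (B 1).IsSimple ∧ 2 * (B 1).dim = p - 1 ∧ IsIsogenous (A 1) (⨁ fun _ : Fin 2 => B 1) ∧
      ∀ i, (((a i : L i)) : K i) = zetaOf (lev i) (K i) ^ ((![3, p] : Fin 2 → ℕ) i) := by
  have hp2 : p ≠ 2 := by omega
  -- sub-pair data, uniformly in the member
  have key : ∀ i : Fin 2, ∃ (L : IntermediateField ℚ (K i)) (Ψ : CMType L) (B : AbelianVariety ℂ) (ιB : 𝓞 L →+* End B)
      (θB : L →+* Module.End ℂ (complexBetti B.X 1)),
      inducedCMType (algebraMap L (K i)) Ψ = Φ i ∧ IsCMTypeRealisation Ψ B ιB θB ∧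
      (lev i = 4 → L = ⊤ ∧ B = A i) ∧
      (lev i ≠ 4 → Module.finrank L (K i) = 2 ∧ zetaOf (lev i) (K i) - (zetaOf (lev i) (K i))⁻¹ ∈ L ∧ B.IsSimple ∧
        4 * B.dim = Nat.totient (lev i) ∧ IsIsogenous (A i) (⨁ fun _ : Fin 2 => B)) ∧
      zetaOf (lev i) (K i) ^ ((![3, p] : Fin 2 → ℕ) i) ∈ L := by
    refine Fin.forall_fin_two.2 ⟨?_, ?_⟩
    · obtain ⟨L, Ψ, ιB, θB, hL, hind, hB⟩ := exists_top_subPair (Φ 0) (hA 0)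
      exact ⟨L, Ψ, A 0, ιB, θB, hind, hB, fun _ => ⟨hL, rfl⟩, fun h => absurd h0 h, by rw [hL]; exact IntermediateField.mem_top⟩
    · have h4 : 4 ∣ lev 1 := ⟨p, h1⟩
      have h8 : 8 ≤ lev 1 := by rw [h1]; omega
      have h20 : lev 1 ≠ 20 := by rw [h1]; omega
      have h24 : lev 1 ≠ 24 := by rw [h1]; omega
      have h60 : lev 1 ≠ 60 := by
        rw [h1]; intro h
        have : p = 15 := by omega
        subst this; exact absurd hp (by decide)
      obtain ⟨L, Ψ, B, ιB, θB, -, -, -, hind, hfin, hL, hζ, hB, hs, hdim, hiso, -, -⟩ :=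
        exists_simpleFactor_retract h4 h8 h20 h24 h60 (hΦ 1) (hA 1)
      have hodd : Odd p := hp.odd_of_ne_two hp2
      obtain ⟨hmem, -⟩ := zetaOf_pow_mem_and_sq_eq_neg_one_of_eq_adjoin (K := K 1) hodd h1 h8 h20 h24 h60 (hΦ 1) hL
      exact ⟨L, Ψ, B, ιB, θB, hind, hB, fun h => absurd h (by rw [h1]; omega), fun _ => ⟨hfin, hζ, hs, hdim, hiso⟩, hmem⟩
  choose L Ψ B ιB θB hind hB hkeep hfac hmem using key
  obtain ⟨hL0, hB0eq⟩ := hkeep 0 h0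
  obtain ⟨hfin1, hζ1, hs1, hdim1, hiso1⟩ := hfac 1 (by rw [h1]; omega)
  have htot : Nat.totient (4 * p) = 2 * (p - 1) := by
    rw [show 4 = 2 ^ 2 by norm_num, Nat.totient_mul ((Nat.coprime_pow_left_iff (by norm_num) 2 p).2
      ((Nat.coprime_primes (by decide) hp).2 hp2.symm)), Nat.totient_prime_pow (by decide) (by norm_num), Nat.totient_prime hp]
    norm_num
  have hd1 : 2 * (B 1).dim = p - 1 := by rw [h1, htot] at hdim1; omega
  -- the integral elements `a_i = ζ_i^{c_i} ∈ 𝓞_{L_i}`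
  have hint : ∀ i, IsIntegral ℤ (⟨zetaOf (lev i) (K i) ^ ((![3, p] : Fin 2 → ℕ) i), hmem i⟩ : L i) := fun i => by
    rw [← isIntegral_algebraMap_iff (algebraMap (L i) (K i)).injective]
    exact ((IsCyclotomicExtension.zeta_spec (lev i) ℚ (K i)).isIntegral (NeZero.pos _)).pow _
  refine ⟨L, Ψ, B, ιB, θB, fun i => ⟨⟨_, hmem i⟩, (mem_integralClosure_iff ℤ (L i)).2 (hint i)⟩, hind, hB, hL0, hB0eq, hfin1, hζ1, hs1, hd1,
    hiso1, fun i => rfl⟩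

/-- **FOR EVERY PRIME `p ≡ 3 (mod 4)`, `p ≥ 7`: a CM elliptic curve `E` (`= E_i`) and a SIMPLE CM abelian variety `Y` of odd dimension `(p−1)/2`
(`= Y_{4p}`) with an endomorphism `φ` of `E ⊕ Y`, `φ² = −1`, such that `(E ⊕ Y, φ)` is of WEIL TYPE `((p+1)/4, 1)`, `B^q(E ⊕ Y) ⊗ ℂ = D^q ⊗ ℂ` for
`4q ≠ p + 1`, `B^m ⊗ ℂ = D^m ⊗ ℂ ⊔ W ⊗ ℂ` with `B^m ≠ D^m` (`m = (p+1)/4`), and `HC(E ⊕ Y) ⟺` the rational `(m,m)` Weil classes of `φ` are algebraic**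
— an infinite family (dimensions `4, 6, 8, 10, …`) of abelian varieties of Weil type whose Hodge ring is `D• ⊕ W`; `p = 7` is Moonen–Zarhin's
case (a). [cite: MoonenZarhin1999LowDim, Thm. 0.1 (a) and (1)] [cite: vanGeemen1994HodgeAV, Thm. 6.12 and 1.1]
[cite: GalleseGoodsonLombardo2024, §3 Thm. 3.0 (5)] -/
theorem exists_cmCurve_simple_odd_weilType_hodgeRing {p : ℕ} (hp : p.Prime) (hp3 : p % 4 = 3) (hp7 : 7 ≤ p) :
    ∃ (X : Fin 2 → AbelianVariety ℂ) (φ : (⨁ X) ⟶ (⨁ X)), (X 0).dim = 1 ∧ (X 1).IsSimple ∧ 2 * (X 1).dim = p - 1 ∧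
      φ ≫ φ = -((1 : ℕ) • 𝟙 (⨁ X)) ∧ IsWeilType (⨁ X) φ ((p + 1) / 4) 1 ∧
      (∀ q : ℕ, 4 * q ≠ p + 1 → hodgeClassSpan (⨁ X).dim (⨁ X).X q = divisorClassesSpan (⨁ X).X (⨁ X).dim q) ∧
      hodgeClassSpan (⨁ X).dim (⨁ X).X ((p + 1) / 4) =
        divisorClassesSpan (⨁ X).X (⨁ X).dim ((p + 1) / 4) ⊔ weilClassesOf (⨁ X) φ ((p + 1) / 4) 1 ∧
      (∃ c : complexBetti (⨁ X).X (2 * ((p + 1) / 4)), IsRationalClass c ∧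
        IsOfHodgeType (⨁ X).dim (⨁ X).X (2 * ((p + 1) / 4)) ((p + 1) / 4) ((p + 1) / 4) c ∧
        c ∉ divisorClassesSpan (⨁ X).X (⨁ X).dim ((p + 1) / 4)) ∧
      (HodgeConjectureFor (⨁ X).dim (⨁ X).X ↔
        ∀ c ∈ weilClassesOf (⨁ X) φ ((p + 1) / 4) 1, IsRationalClass c →
          IsOfHodgeType (2 * ((p + 1) / 4)) (⨁ X).X (2 * ((p + 1) / 4)) ((p + 1) / 4) ((p + 1) / 4) c →
            c ∈ algebraicClasses (⨁ X).X ((p + 1) / 4)) := by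
  classical
  obtain ⟨K, _, _, _, _, Φ, A, ι, θ, hΦ, hA⟩ := exists_realisation_family (![4, 4 * p] : Fin 2 → ℕ)
    (Fin.forall_fin_two.2 ⟨by show (4 : ℕ) = 4 * (4 / 4); norm_num, by
      show (4 * p : ℕ) = 4 * (4 * p / 4)
      rw [Nat.mul_div_cancel_left p (by norm_num)]⟩)
    (Fin.forall_fin_two.2 ⟨by show 0 < 4 / 4; norm_num, by
      show 0 < 4 * p / 4
      rw [Nat.mul_div_cancel_left p (by norm_num)]; exact hp.pos⟩)
  have h0 : (![4, 4 * p] : Fin 2 → ℕ) 0 = 4 := rfl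
  have h1 : (![4, 4 * p] : Fin 2 → ℕ) 1 = 4 * p := rfl
  obtain ⟨L, Ψ, B, ιB, θB, a, hind, hB, hL0, hB0, hfin1, hζ1, hs1, hd1, -, ha⟩ := exists_data hp hp7 h0 h1 hΦ hA
  haveI : ∀ i, IsCMField (L i) := isCMField_subPair (two_lt_lev hp h0 h1) Ψ
  have ha2 := sq_a_eq hp h0 h1 a ha
  have hdA0 : 2 * (A 0).dim = Nat.totient 4 := IsCMTypeRealisation.two_mul_dim_eq_totient (m := (![4, 4 * p] : Fin 2 → ℕ) 0) (by show 2 < 4; norm_num) (hA 0)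
  rw [show Nat.totient 4 = 2 by decide] at hdA0
  have hT := CMAlgebra.CorankOne.mem_weilFibre_iff_conj_smul_not_mem a one_pos ha2
  have hcard := CMAlgebra.CorankOne.two_mul_card_eq_sum_finrank hT
  obtain ⟨hm4, -⟩ := four_mul_eq hp hp3 h0 h1 hL0 hfin1
  refine ⟨B, biproduct.map fun i => ιB i (a i), by rw [hB0]; omega, hs1, hd1, biproduct_map_comp_self_eq_neg a ha2,
    isWeilType hp hp3 h0 h1 hΦ hind hL0 hfin1 a ha hB,
    fun q hq => hodgeClassSpan_eq_divisorClassesSpan_of_ne hp hp3 h0 h1 hΦ hind hL0 hfin1 a ha hB hq,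
    hodgeClassSpan_eq_divisorClassesSpan_sup_weilClassesOf hp hp3 hp7 h0 h1 hΦ hind hL0 hfin1 a ha hB,
    CMAlgebra.CorankOne.exists_exceptional hB ⟨by omega, isGaloisBalancedAlg_weilFibre hp hp3 h0 h1 hΦ hind hL0 hfin1 a ha⟩
      (weilFibre_not_mem_pohlmannDivisorSetsAlg hp hp3 hp7 h0 h1 hΦ hind hL0 hfin1 hζ1 a ha),
    hodgeConjectureFor_iff_weilClasses_algebraic hp hp3 h0 h1 hΦ hind hL0 hfin1 a ha hB⟩

end Existence

/-! ## §8 The exact rank: `ℚ(i) ↪ End⁰(Y_{4p})` and `E_i` is ABSORBED — `rank Hg(E_i × Y_{4p}) = rank Hg(Y_{4p}) = (p+1)/2` -/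

section Rank

variable {lev : Fin 2 → ℕ} [∀ i, NeZero (lev i)] {K : Fin 2 → Type} [∀ i, Field (K i)] [∀ i, NumberField (K i)]
  [∀ i, IsCyclotomicExtension {lev i} ℚ (K i)] {Φ : ∀ i, CMType (K i)}
  {L : ∀ i, IntermediateField ℚ (K i)} {Ψ : ∀ i, CMType (L i)} {p : ℕ}

/-- **`k = ℚ(i) = L_0` EMBEDS INTO THE CM FIELD `L_1` OF `Y_{4p}`** — Moonen–Zarhin's hypothesis «there exists an embedding `k ↪ End⁰(X₂)`» of case (a),
as a ring homomorphism `L_0 → L_1`: `a_1 = ζ_{4p}^p ∈ L_1` is a primitive fourth root of unity, so `X⁴ − 1` splits in `L_1` and the cyclotomic field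
`K_0 = ℚ(ζ_4) ⊇ L_0` (a splitting field of `X⁴ − 1`) maps to `L_1`. [cite: MoonenZarhin1999LowDim, Introduction (a) and Thm. 0.1 (1)]
[cite: Washington1997, Thm. 2.5] -/
theorem nonempty_ringHom_subPair (hp : p.Prime) (h0 : lev 0 = 4) (h1 : lev 1 = 4 * p) (a : ∀ i, 𝓞 (L i))
    (ha : ∀ i, (((a i : L i)) : K i) = zetaOf (lev i) (K i) ^ ((![3, p] : Fin 2 → ℕ) i)) : Nonempty (L 0 →+* L 1) := by
  -- `a_1` is a primitive fourth root of unity in `L_1`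
  have hζ : IsPrimitiveRoot (zetaOf (lev 1) (K 1)) (lev 1) := IsCyclotomicExtension.zeta_spec (lev 1) ℚ (K 1)
  have h4K : IsPrimitiveRoot (zetaOf (lev 1) (K 1) ^ p) 4 :=
    hζ.pow (by rw [h1]; have := hp.pos; omega) (show lev 1 = p * 4 by rw [h1]; ring)
  have h4 : IsPrimitiveRoot (a 1 : L 1) 4 := by
    refine IsPrimitiveRoot.of_map_of_injective (f := algebraMap (L 1) (K 1)) ?_ (algebraMap (L 1) (K 1)).injective
    show IsPrimitiveRoot (((a 1 : L 1)) : K 1) 4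
    rw [ha 1]
    exact h4K
  have hsplit : ((Polynomial.X ^ 4 - 1 : Polynomial ℚ).map (algebraMap ℚ (L 1))).Splits := by
    rw [Polynomial.map_sub, Polynomial.map_pow, Polynomial.map_X, Polynomial.map_one]
    have h := Polynomial.X_pow_sub_one_splits h4
    rwa [map_one] at h
  haveI : Polynomial.IsSplittingField ℚ (K 0) (Polynomial.X ^ (lev 0) - 1) :=
    IsCyclotomicExtension.isSplittingField_X_pow_sub_one (lev 0) ℚ (K 0)
  have hsplit' : ((Polynomial.X ^ (lev 0) - 1 : Polynomial ℚ).map (algebraMap ℚ (L 1))).Splits := by rw [h0]; exact hsplit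
  exact ⟨(Polynomial.IsSplittingField.lift (K 0) (Polynomial.X ^ (lev 0) - 1) hsplit').toRingHom.comp (algebraMap (L 0) (K 0))⟩

/-- **`Y_{4p}` IS NONDEGENERATE for `p ≡ 3 (mod 4)`** (`cmTypeRank Ψ_1 = (p+1)/2 = dim + 1`; Yanai §5 «`dim MT(A) = dim A + 1` … stably nondegenerate»).
[cite: Yanai2015IndexDegeneracy, §5 (p. 819)] [cite: Gordon1999HodgeAVSurvey, Thm. 6.4 and 7.5] -/
theorem isNondegenerate_subPair_one (hp : p.Prime) (hp3 : p % 4 = 3) (h0 : lev 0 = 4) (h1 : lev 1 = 4 * p)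
    (hΦ : ∀ i (σ : K i →+* ℂ), σ ∈ (Φ i).1 ↔ 2 * (expOf (lev i) (K i) σ).val < lev i)
    (hind : ∀ i, inducedCMType (algebraMap (L i) (K i)) (Ψ i) = Φ i) (hL0 : L 0 = ⊤) (hfin1 : Module.finrank (L 1) (K 1) = 2) :
    IsNondegenerate (Ψ 1) := by
  haveI : ∀ i, IsCMField (L i) := isCMField_subPair (two_lt_lev hp h0 h1) Ψ
  rw [isNondegenerate_iff, ← cmTypeRank_inducedCMType (algebraMap (L 1) (K 1)) (Ψ 1), hind 1,
    cmTypeRank_eq_of_level_fourMulPrime hp (by omega) h1 (Φ 1) (hΦ 1), if_neg (by omega), (finrank_subPair_eq hp hp3 h0 h1 hL0 hfin1).2]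
  omega

/-- **THE EXACT RANK OF THE PAIR: `cmFamilyRank (Ψ_0, Ψ_1) = (p+1)/2 = cmTypeRank Ψ_1`** — `rank Hg(E_i × Y_{4p}) = rank Hg(Y_{4p}) = dim Y_{4p} + 1`:
the CM elliptic curve `E_i` is ABSORBED (curve absorption, `MultiFieldWeil.cmFamilyRank_comp_eq_of_quadratic_slot_of_odd`: `k = L_0` quadratic,
`k ↪ L_1`, `[L_1 : ℚ]/2 = (p−1)/2` odd), i.e. `Hg(E_i × Y_{4p}) → Hg(Y_{4p})` is an isogeny and `Hg(E_i × Y_{4p}) ≠ Hg(E_i) × Hg(Y_{4p})` —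
Moonen–Zarhin (a).  In particular the pair has Kubota corank EXACTLY one: `(Σ_i [L_i:ℚ])/2 = (p+1)/2 = cmFamilyRank Ψ` (g54's numerics
«`rank MT(X_4 × Y_{4p}) = rank MT(Y_{4p})`» as a theorem). [cite: MoonenZarhin1999LowDim, Thm. 0.1 (a) and §3 (3.1)] [cite: Deligne1982HodgeCycles, I Ex. 3.7 (c)]
[cite: Yanai2015IndexDegeneracy, §5 (p. 819)] -/
theorem cmFamilyRank_eq (hp : p.Prime) (hp3 : p % 4 = 3) (h0 : lev 0 = 4) (h1 : lev 1 = 4 * p)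
    (hΦ : ∀ i (σ : K i →+* ℂ), σ ∈ (Φ i).1 ↔ 2 * (expOf (lev i) (K i) σ).val < lev i)
    (hind : ∀ i, inducedCMType (algebraMap (L i) (K i)) (Ψ i) = Φ i) (hL0 : L 0 = ⊤) (hfin1 : Module.finrank (L 1) (K 1) = 2)
    (a : ∀ i, 𝓞 (L i)) (ha : ∀ i, (((a i : L i)) : K i) = zetaOf (lev i) (K i) ^ ((![3, p] : Fin 2 → ℕ) i)) :
    CMAlgebra.cmFamilyRank Ψ = (p + 1) / 2 ∧ CMAlgebra.cmFamilyRank Ψ = cmTypeRank (Ψ 1) ∧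
      CMAlgebra.cmFamilyRank Ψ = (∑ i, finrank ℚ (L i)) / 2 := by
  haveI : ∀ i, IsCMField (L i) := isCMField_subPair (two_lt_lev hp h0 h1) Ψ
  obtain ⟨e⟩ := nonempty_ringHom_subPair hp h0 h1 a ha
  obtain ⟨hd0, hd1⟩ := finrank_subPair_eq hp hp3 h0 h1 hL0 hfin1
  have hodd : ¬2 ∣ finrank ℚ (L ((fun _ : Unit => (1 : Fin 2)) ())) / 2 := by
    show ¬2 ∣ finrank ℚ (L 1) / 2
    rw [hd1]; omega
  have habs := MultiFieldWeil.cmFamilyRank_comp_eq_of_quadratic_slot_of_odd Ψ (i₀ := 0) hd0 (fun _ : Unit => (1 : Fin 2))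
    (fun i hi => ⟨(), by
      rcases Fin.eq_zero_or_eq_succ i with h | ⟨j, rfl⟩
      · exact absurd h hi
      · exact (Fin.fin_one_eq_zero j).symm ▸ rfl⟩) () e hodd
  have hnd := isNondegenerate_subPair_one hp hp3 h0 h1 hΦ hind hL0 hfin1
  have hone := MultiFieldWeil.cmFamilyRank_eq_of_isNondegenerate_of_unique (I := Unit) (fun _ : Unit => Ψ 1) hnd
  have hrk : cmTypeRank (Ψ 1) = p / 2 + 1 := by
    rw [← cmTypeRank_inducedCMType (algebraMap (L 1) (K 1)) (Ψ 1), hind 1,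
      cmTypeRank_eq_of_level_fourMulPrime hp (by omega) h1 (Φ 1) (hΦ 1), if_neg (by omega)]
  rw [sum_finrank_eq hp hp3 h0 h1 hL0 hfin1, ← habs, hone, hrk]
  simp only [hd1]
  omega

end Rank

end HyperellipticJacobian

end Literature.AlgebraicGeometry.ComplexMultiplication

end
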